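import Summits.HubbardSuperconductivity.HubbardSuperconductivity.Theorems.HyperoctahedralMottCompleteGraphAnchorBlocks

/-!
# Route `HyperoctahedralMott`, support `CompleteGraphAnchor` (item stmt-HubbardSuperconductivity-6677):
# the sector minimiser

Helper file 5/6. Given a block structure `label : Λ → {0,…,k}` (blocks `B_j = label⁻¹ j`, `j < k`,
top fiber `U = label⁻¹ k`) with two designated sites `a j ≠ b j` in each block, the projected
block state `ψ₀ = P · Π_{j<k} (C↑†[B_j] C↓†[B_j]) · |U all up⟩` is a nonzero Gutzwiller vector with
`|U| + 2k` electrons and `S^z = |U|/2`, killed by `S⁺` and by the projected zero-momentum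
creators `P C_σ†` (`exists_minimiser`): a highest-weight vector of the dominant `gl(1|2)`
constituent (fat hook `(|B_{k-1}|, 2^{k-1}, 1^{|U|})`), hence a minimiser of the interchange
Laplacian on its sector by the sum-of-squares identity. Nonvanishing is read off the amplitude on
the designated configuration (`a j` up, `b j` down). No definitions. [folklore]
-/

-- the mandated namespace `Summit.<Summit>.<Problem>.Theorems` repeats `HubbardSuperconductivity`
-- (single-problem summit, D-0017), which the `dupNamespace` linter flags on every declaration
set_option linter.dupNamespace false

noncomputable section

namespace Summit.HubbardSuperconductivity.HubbardSuperconductivity.Theorems.HyperoctahedralMott.Anchor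

open Matrix Finset Literature.MathematicalPhysics.QuantumLattice HubbardWave0
open scoped ComplexOrder

/-! ### The minimiser: block configuration and existence -/

section MinimiserConstruction

variable {Λ : Type*} [LinearOrder Λ] [Fintype Λ]

omit [Fintype Λ] in
/-- Membership in the designated configuration of a list of blocks. [folklore] -/
theorem mem_blockCfg_iff (a b : ℕ → Λ) (C : Finset (Orb Λ)) (J : List ℕ) (o : Orb Λ) :
    o ∈ J.foldr (fun j s => insert (orb (a j) 0) (insert (orb (b j) 1) s)) C ↔
      o ∈ C ∨ ∃ j ∈ J, o = orb (a j) 0 ∨ o = orb (b j) 1 := by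
  induction J with
  | nil => simp
  | cons j J ih =>
    rw [List.foldr_cons, Finset.mem_insert, Finset.mem_insert, ih, List.exists_mem_cons_iff]
    constructor
    · rintro (h | h | h | h)
      · exact Or.inr (Or.inl (Or.inl h))
      · exact Or.inr (Or.inl (Or.inr h))
      · exact Or.inl h
      · exact Or.inr (Or.inr h)
    · rintro (h | (h | h) | h)
      · exact Or.inr (Or.inr (Or.inl h))
      · exact Or.inl h
      · exact Or.inr (Or.inl h)
      · exact Or.inr (Or.inr (Or.inr h))

/-- Membership in the all-up configuration of the top fiber. [folklore] -/
theorem mem_upCfg_iff (label : Λ → ℕ) (k : ℕ) (x : Λ) (σ : Fin 2) :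
    orb x σ ∈ (univ.filter fun y => label y = k).image (fun y => orb y 0) ↔ σ = 0 ∧ label x = k := by
  rw [Finset.mem_image]
  constructor
  · rintro ⟨y, hy, h⟩
    obtain ⟨rfl, rfl⟩ := orb_inj.1 h
    exact ⟨rfl, (Finset.mem_filter.1 hy).2⟩
  · rintro ⟨rfl, h⟩
    exact ⟨x, Finset.mem_filter.2 ⟨Finset.mem_univ _, h⟩, rfl⟩

/-- Up orbitals of the designated configuration: top-fiber sites or designated `a`-sites.
[folklore] -/
theorem label_of_up_mem_blockCfg {label : Λ → ℕ} {a b : ℕ → Λ} {k : ℕ} {J : List ℕ} {x : Λ}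
    (h : orb x 0 ∈ J.foldr (fun j s => insert (orb (a j) 0) (insert (orb (b j) 1) s))
      ((univ.filter fun y => label y = k).image (fun y => orb y 0))) :
    label x = k ∨ ∃ j ∈ J, x = a j := by
  rcases (mem_blockCfg_iff a b _ J _).1 h with h | ⟨j, hj, h | h⟩
  · exact Or.inl ((mem_upCfg_iff label k x 0).1 h).2
  · exact Or.inr ⟨j, hj, (orb_inj.1 h).1⟩
  · exact absurd (orb_inj.1 h).2 (by decide)

/-- Down orbitals of the designated configuration are designated `b`-sites. [folklore] -/
theorem exists_of_down_mem_blockCfg {label : Λ → ℕ} {a b : ℕ → Λ} {k : ℕ} {J : List ℕ} {x : Λ}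
    (h : orb x 1 ∈ J.foldr (fun j s => insert (orb (a j) 0) (insert (orb (b j) 1) s))
      ((univ.filter fun y => label y = k).image (fun y => orb y 0))) :
    ∃ j ∈ J, x = b j := by
  rcases (mem_blockCfg_iff a b _ J _).1 h with h | ⟨j, hj, h | h⟩
  · exact absurd ((mem_upCfg_iff label k x 1).1 h).1 (by decide)
  · exact absurd (orb_inj.1 h).2 (by decide)
  · exact ⟨j, hj, (orb_inj.1 h).1⟩

/-- The designated configuration of the blocks `j < k` has no double occupancy. [folklore] -/
theorem not_hasDoubleOccupancy_blockCfg {label : Λ → ℕ} {a b : ℕ → Λ} {k : ℕ}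
    (ha : ∀ j < k, label (a j) = j) (hb : ∀ j < k, label (b j) = j) (hab : ∀ j < k, a j ≠ b j)
    {J : List ℕ} (hJ : ∀ j ∈ J, j < k) :
    ¬ HasDoubleOccupancy (J.foldr (fun j s => insert (orb (a j) 0) (insert (orb (b j) 1) s))
      ((univ.filter fun y => label y = k).image (fun y => orb y 0))) := by
  rintro ⟨z, hz0, hz1⟩
  obtain ⟨i, hi, rfl⟩ := exists_of_down_mem_blockCfg hz1
  have hik : i < k := hJ i hi
  rcases label_of_up_mem_blockCfg hz0 with h | ⟨i', hi', h⟩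
  · rw [hb i hik] at h
    exact absurd h hik.ne
  · have : i' = i := by rw [← ha i' (hJ i' hi'), ← h, hb i hik]
    subst this
    exact hab i' hik h.symm

/-- **The product of block pair creators does not vanish on the all-up top fiber**: its
amplitude on the designated configuration (site `a j` up and `b j` down in block `j`) is a sign.
[folklore] -/
theorem blockProd_mulVec_single_apply_ne_zero (label : Λ → ℕ) (a b : ℕ → Λ) (k : ℕ)
    (ha : ∀ j < k, label (a j) = j) (hb : ∀ j < k, label (b j) = j)
    (J : List ℕ) (hJ : ∀ j ∈ J, j < k) (hnd : J.Nodup) :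
    (((J.map fun j => univ.filter fun x => label x = j).map fun S : Finset Λ =>
        (∑ x ∈ S, creation (orb x 0)) * (∑ x ∈ S, creation (orb x 1))).prod *ᵥ
        Pi.single ((univ.filter fun y => label y = k).image (fun y => orb y 0)) (1 : ℂ))
      (J.foldr (fun j s => insert (orb (a j) 0) (insert (orb (b j) 1) s))
        ((univ.filter fun y => label y = k).image (fun y => orb y 0))) ≠ 0 := by
  induction J with
  | nil => simp
  | cons j J ih =>
    have hjk : j < k := hJ j List.mem_cons_self
    have hJ' : ∀ i ∈ J, i < k := fun i hi => hJ i (List.mem_cons_of_mem _ hi)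
    have hjJ : j ∉ J := (List.nodup_cons.1 hnd).1
    have IH := ih hJ' (List.nodup_cons.1 hnd).2
    set s' := J.foldr (fun j s => insert (orb (a j) 0) (insert (orb (b j) 1) s))
      ((univ.filter fun y => label y = k).image (fun y => orb y 0)) with hs'
    set V := (((J.map fun j => univ.filter fun x => label x = j).map fun S : Finset Λ =>
        (∑ x ∈ S, creation (orb x 0)) * (∑ x ∈ S, creation (orb x 1))).prod *ᵥ
        Pi.single ((univ.filter fun y => label y = k).image (fun y => orb y 0)) (1 : ℂ)) with hV
    -- the new block's designated orbitals are fresh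
    have hB : orb (b j) 1 ∉ s' := fun h => by
      obtain ⟨i, hi, e⟩ := exists_of_down_mem_blockCfg h
      have : j = i := by rw [← hb j hjk, e, hb i (hJ' i hi)]
      exact hjJ (this ▸ hi)
    have hup : ∀ x, label x = j → orb x 0 ∉ s' := fun x hx h => by
      rcases label_of_up_mem_blockCfg h with h' | ⟨i, hi, e⟩
      · exact absurd (hx.symm.trans h') hjk.ne
      · have : j = i := by rw [← hx, e, ha i (hJ' i hi)]
        exact hjJ (this ▸ hi)
    have hA : orb (a j) 0 ∉ insert (orb (b j) 1) s' := fun h => by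
      rcases Finset.mem_insert.1 h with e | h
      · exact absurd (orb_inj.1 e).2 (by decide)
      · exact hup (a j) (ha j hjk) h
    rw [List.map_cons, List.map_cons, List.prod_cons, ← mulVec_mulVec, List.foldr_cons, ← mulVec_mulVec,
      sum_mulVec, Finset.sum_apply, Finset.sum_eq_single (a j)]
    · rw [sum_mulVec, mulVec_sum, Finset.sum_apply, Finset.sum_eq_single (b j)]
      · rw [EtaPairingODLRO.creation_mulVec_apply, if_pos (Finset.mem_insert_self _ _),
          Finset.erase_insert hA, EtaPairingODLRO.creation_mulVec_apply,
          if_pos (Finset.mem_insert_self _ _), Finset.erase_insert hB]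
        exact mul_ne_zero (jwSign_ne_zero _ _) (mul_ne_zero (jwSign_ne_zero _ _) IH)
      · intro y hy hyb
        have hy' : label y = j := (Finset.mem_filter.1 hy).2
        rw [EtaPairingODLRO.creation_mulVec_apply, if_pos (Finset.mem_insert_self _ _),
          Finset.erase_insert hA, EtaPairingODLRO.creation_mulVec_apply, if_neg, mul_zero]
        intro h
        rcases Finset.mem_insert.1 h with e | h
        · exact hyb (orb_inj.1 e).1
        · obtain ⟨i, hi, e⟩ := exists_of_down_mem_blockCfg h
          have : j = i := by rw [← hy', e, hb i (hJ' i hi)]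
          exact hjJ (this ▸ hi)
      · exact fun h => absurd (Finset.mem_filter.2 ⟨Finset.mem_univ (b j), hb j hjk⟩) h
    · intro x hx hxa
      have hx' : label x = j := (Finset.mem_filter.1 hx).2
      rw [EtaPairingODLRO.creation_mulVec_apply, if_neg]
      intro h
      rcases Finset.mem_insert.1 h with e | h
      · exact hxa (orb_inj.1 e).1
      · rcases Finset.mem_insert.1 h with e | h
        · exact absurd (orb_inj.1 e).2 (by decide)
        · exact hup x hx' h
    · exact fun h => absurd (Finset.mem_filter.2 ⟨Finset.mem_univ (a j), ha j hjk⟩) h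

/-- The Gutzwiller projector kills a doubly occupied basis vector. [folklore] -/
theorem gutzwillerProj_mulVec_single_of_hasDoubleOccupancy {t : Finset (Orb Λ)}
    (ht : HasDoubleOccupancy t) (c : ℂ) : gutzwillerProj *ᵥ Pi.single t c = 0 := by
  funext s
  rw [NagaokaTasaki.gutzwillerProj_mulVec_apply, Pi.zero_apply]
  by_cases hs : s = t
  · subst hs
    rw [if_pos ht]
  · rw [Pi.single_eq_of_ne hs]
    split_ifs <;> rfl

/-- `S⁺` kills an all-up basis vector. [folklore] -/
theorem spinPlus_mulVec_single_of_no_down {t : Finset (Orb Λ)} (ht : ∀ x : Λ, orb x 1 ∉ t) :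
    spinPlus *ᵥ Pi.single t (1 : ℂ) = 0 := by
  rw [spinPlus, sum_mulVec]
  refine Finset.sum_eq_zero fun w _ => ?_
  rw [← mulVec_mulVec, annihilation_mulVec_single, if_neg (ht w), mulVec_zero]

/-- **Existence of the sector minimiser.** Given a block structure `label : Λ → {0,…,k}` with two
designated sites `a j ≠ b j` in every block `j < k`, the projected state
`ψ₀ = P · Π_{j<k} (C↑[B_j] C↓[B_j]) · |top fiber all up⟩` is a nonzero Gutzwiller vector with
`|U| + 2k` electrons and `S^z = |U|/2` (`U` the top fiber) which is killed by `S⁺` and by both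
projected zero-momentum creators `P C_σ†`. [folklore] -/
theorem exists_minimiser (label : Λ → ℕ) (a b : ℕ → Λ) (k : ℕ) (hlab : ∀ x, label x ≤ k)
    (ha : ∀ j < k, label (a j) = j) (hb : ∀ j < k, label (b j) = j) (hab : ∀ j < k, a j ≠ b j) :
    ∃ ψ : Fock (Orb Λ), ψ ≠ 0 ∧ IsGutzwiller ψ ∧
      IsNParticle ((univ.filter fun x => label x = k).card + 2 * k) ψ ∧
      spinZ *ᵥ ψ = ((((univ.filter fun x => label x = k).card : ℕ) : ℂ) / 2) • ψ ∧
      spinPlus *ᵥ ψ = 0 ∧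
      gutzwillerProj *ᵥ ((∑ x : Λ, creation (orb x 0)) *ᵥ ψ) = 0 ∧
      gutzwillerProj *ᵥ ((∑ x : Λ, creation (orb x 1)) *ᵥ ψ) = 0 := by
  set U : Finset Λ := univ.filter fun x => label x = k with hU
  set cfgU : Finset (Orb Λ) := U.image fun y => orb y 0 with hcfgU
  set φ : Fock (Orb Λ) := Pi.single cfgU (1 : ℂ) with hφ
  set L : List (Finset Λ) := (List.range k).map fun j => univ.filter fun x => label x = j with hL
  -- fibers and the decomposition of the zero-momentum creators
  have hmem : ∀ j < k, (univ.filter fun x : Λ => label x = j) ∈ L := fun j hj =>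
    List.mem_map.2 ⟨j, List.mem_range.2 hj, rfl⟩
  have hCF : ∀ σ : Fin 2, (∑ x : Λ, creation (orb x σ)) *
      (L.map fun S : Finset Λ => (∑ x ∈ S, creation (orb x 0)) * (∑ x ∈ S, creation (orb x 1))).prod =
      (L.map fun S : Finset Λ => (∑ x ∈ S, creation (orb x 0)) * (∑ x ∈ S, creation (orb x 1))).prod *
        ∑ x ∈ U, creation (orb x σ) := by
    intro σ
    show _ = _ * ∑ x ∈ univ.filter (fun x => label x = k), creation (orb x σ)
    rw [← Finset.sum_fiberwise_of_maps_to (s := univ) (t := Finset.range (k + 1)) (g := label)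
      (fun x _ => Finset.mem_range.2 (Nat.lt_succ_of_le (hlab x))) (fun x => creation (orb x σ)),
      Finset.range_add_one, Finset.sum_insert Finset.notMem_range_self, add_mul,
      Finset.sum_mul (s := Finset.range k),
      Finset.sum_eq_zero (fun j hj => sum_creation_mul_blockProd_eq_zero
        (hmem j (Finset.mem_range.1 hj)) σ), add_zero, sum_creation_mul_blockProd]
  have hPC : ∀ (σ : Fin 2) (w : Fock (Orb Λ)),
      gutzwillerProj *ᵥ ((∑ x : Λ, creation (orb x σ)) *ᵥ (gutzwillerProj *ᵥ w)) =
        gutzwillerProj *ᵥ ((∑ x : Λ, creation (orb x σ)) *ᵥ w) := by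
    intro σ w
    rw [mulVec_mulVec, mulVec_mulVec, ← proj_mul_eq_of_sum _ _ fun x _ => gutzwillerProj_mul_creation_eq _,
      ← mulVec_mulVec]
  -- the all-up top fiber
  have hupφ : ∀ x ∈ U, orb x 0 ∈ cfgU := fun x hx => Finset.mem_image_of_mem _ hx
  have hdnφ : ∀ x : Λ, orb x 1 ∉ cfgU := fun x h => absurd ((mem_upCfg_iff label k x 1).1 h).1 (by decide)
  have hSφ : spinPlus *ᵥ φ = 0 := spinPlus_mulVec_single_of_no_down hdnφ
  have hC0φ : (∑ x ∈ U, creation (orb x 0)) *ᵥ φ = 0 := by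
    rw [sum_mulVec]
    refine Finset.sum_eq_zero fun x hx => ?_
    rw [hφ, FermionOperatorsProofs.creation_mulVec_single, if_pos (hupφ x hx)]
  have hPχ : gutzwillerProj *ᵥ ((∑ x ∈ U, creation (orb x 1)) *ᵥ φ) = 0 := by
    rw [sum_mulVec, mulVec_sum]
    refine Finset.sum_eq_zero fun x hx => ?_
    rw [hφ, FermionOperatorsProofs.creation_mulVec_single, if_neg (hdnφ x), mulVec_smul,
      gutzwillerProj_mulVec_single_of_hasDoubleOccupancy
        ⟨x, Finset.mem_insert_of_mem (hupφ x hx), Finset.mem_insert_self _ _⟩, smul_zero]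
  refine ⟨gutzwillerProj *ᵥ ((L.map fun S : Finset Λ =>
      (∑ x ∈ S, creation (orb x 0)) * (∑ x ∈ S, creation (orb x 1))).prod *ᵥ φ),
    ?_, ?_, ?_, ?_, ?_, ?_, ?_⟩
  · -- nonzero
    have hJ : ∀ j ∈ List.range k, j < k := fun j hj => List.mem_range.1 hj
    have hne := blockProd_mulVec_single_apply_ne_zero label a b k ha hb (List.range k) hJ
      List.nodup_range
    have hdbl := not_hasDoubleOccupancy_blockCfg ha hb hab hJ
    intro h0
    have h1 := congrFun h0 ((List.range k).foldr
      (fun j s => insert (orb (a j) 0) (insert (orb (b j) 1) s)) cfgU)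
    rw [NagaokaTasaki.gutzwillerProj_mulVec_apply, if_neg hdbl, Pi.zero_apply] at h1
    exact hne h1
  · -- Gutzwiller
    rw [← gutzwillerProj_mulVec_eq_self_iff, mulVec_mulVec, gutzwillerProj_mul_self]
  · -- particle number
    have hcard : cfgU.card = U.card :=
      Finset.card_image_of_injective _ fun x y h => (orb_inj.1 h).1
    have h := isNParticle_blockProd_mulVec (isNParticle_single hcard) L
    rw [hL, List.length_map, List.length_range] at h
    exact isNParticle_gutzwillerProj_mulVec h
  · -- S^z
    have hup : (univ.filter fun x : Λ => orb x 0 ∈ cfgU) = U := by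
      ext x
      rw [Finset.mem_filter, mem_upCfg_iff, hU, Finset.mem_filter]
      simp
    have hdn : (univ.filter fun x : Λ => orb x 1 ∈ cfgU) = ∅ := by
      ext x
      rw [Finset.mem_filter, mem_upCfg_iff]
      simp
    have hφz : spinZ *ᵥ φ = (((U.card : ℕ) : ℂ) / 2) • φ := by
      funext s
      rw [NagaokaTasaki.spinZ_mulVec_apply, Pi.smul_apply, smul_eq_mul, hφ]
      by_cases hs : s = cfgU
      · subst hs
        rw [upCount, NagaokaTasaki.downCount, hup, hdn, Finset.card_empty, Nat.cast_zero, sub_zero]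
        ring
      · rw [Pi.single_eq_of_ne hs, mul_zero, mul_zero]
    rw [spinZ_mulVec_gutzwillerProj_mulVec, mulVec_mulVec φ spinZ, spinZ_mul_blockProd, ← mulVec_mulVec,
      hφz, mulVec_smul, mulVec_smul]
  · -- S⁺
    rw [mulVec_mulVec _ spinPlus gutzwillerProj, ← gutzwillerProj_mul_spinPlus, ← mulVec_mulVec,
      mulVec_mulVec φ spinPlus, spinPlus_mul_blockProd, ← mulVec_mulVec, hSφ, mulVec_zero, mulVec_zero]
  · -- P C↑†
    rw [hPC, mulVec_mulVec φ (∑ x : Λ, creation (orb x 0)), hCF 0, ← mulVec_mulVec, hC0φ, mulVec_zero,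
      mulVec_zero]
  · -- P C↓†
    rw [hPC, mulVec_mulVec φ (∑ x : Λ, creation (orb x 1)), hCF 1, ← mulVec_mulVec,
      mulVec_mulVec _ gutzwillerProj, gutzwillerProj_mul_blockProd_eq, ← mulVec_mulVec, hPχ, mulVec_zero]

end MinimiserConstruction

end Summit.HubbardSuperconductivity.HubbardSuperconductivity.Theorems.HyperoctahedralMott.Anchor
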